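import Mathlib
import HarnessLib
import Summits.HubbardSuperconductivity.HubbardSuperconductivity.Theorems.KLProgrammeKLRegimeTwoVolumeTowerDataTSWOfReadoutsH0
import Summits.HubbardSuperconductivity.HubbardSuperconductivity.Theorems.KLProgrammeKLRegimeTwoVolumeTowerTruncProfileBridgeSW
import Summits.HubbardSuperconductivity.HubbardSuperconductivity.Theorems.KLProgrammeKLRegimeTwoVolumeTowerBudgetGeomA

/-!
# Route `KLProgramme` — crux K3, VL child `KLRegimeVolumeLimitV17F3` (stmt-HubbardSuperconductivity-23356), cure of LR13′ «(VL)-HUV-CURRENCY-PROPAGATION»,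
# consumer step C2a′ (cure (c1) of «(VL)-HE1-LEVEL0-DEG2»): THE DATA PACKAGE WITH TOKEN #24-W AND E1's DEGREE-2 LAW RE-TYPED AT `εb`
# (twin of `…TowerDataTSWOfReadoutsH0W.towerDataTSW_of_readoutsH0W`; seat hubbard-kl-k3c4-p1 g20; `--supports` 23356)

Byte-identical to `towerDataTSW_of_readoutsH0` (k3c4-p1 g16/g17) except:
* the two token-#24 clauses of `hinst` read `SourceProfilesAtLevF … (srcWindowFamily _ M) j (r j) (j+1)` (`…TwoVolumeSourceProfileDefsF`) instead of the PLAIN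
  `SourceProfilesAtLev`;
* the one-volume bundles `TowerVolumeDataTSW … NV` are built DIRECTLY by `…TowerTruncProfileBridgeSW.towerVolumeDataTSW_of_readoutW` (no
  `TowerVolumeDataTS.smooth`, so the `ℓ¹` rows `hCr/hCc` of the smoothing kernel are not asked); the budgets stay `NV` (`NV j m ≤ Aj j·q j^m ≤ Aj j·qκ j^m` since
  `qκ = (max 1 Cw)²·q ≥ q`) — the free real `Cw` is kept in the four scale-free inequalities so that every caller's arithmetic is unchanged.

* E1's alive law `hS₀law` is asked only in the degrees `2m ≥ 4`; the degree-2 values obey `hS₀two : S₀ j 2 ≤ C₀·Q.CE·εb·4^{−(j+1)}` (`εb ≥ ε_{j+1}`; the caller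
  takes `εb := ε_{n_β+1}`); the geometric majorant uses `…TowerBudgetGeomA.towerBudget_le_geom'/towerBudgetConst_le_laws'` (`Aj j := εb·32^{−j}·2K`) and the
  smallness `hsmall` is asked at `εb` with `2K` (`towerSmallnessIneq_of_laws_lt` at the constant sequence `εb`).
* **`towerDataTSW_of_readoutsH0WA`**.

Proofs only; no definition.  Honest framing: a conditional constructor; nothing here asserts `h0T`, the read-outs, any stub, K3, VL or superconductivity.
[cite: BenfattoGiulianiMastropietro2006, §2.7-§2.9 and §3]
-/

noncomputable section

namespace Summit.HubbardSuperconductivity.HubbardSuperconductivity.Theorems.TwoVolumeSource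

set_option linter.dupNamespace false -- summit = problem name (single-conjunct summit), D-0017

open Finset Filter Topology Literature.MathematicalPhysics.QuantumLattice GrassmannAlgebra Literature.Probability.LatticeModels
  Literature.Probability.LatticeModels.BattleFederbush
open Summit.HubbardSuperconductivity.HubbardSuperconductivity.Theorems.KLRegimeSplit
open Summit.HubbardSuperconductivity.HubbardSuperconductivity.Theorems.KLProgrammeLegKernels
open Summit.HubbardSuperconductivity.HubbardSuperconductivity.Theorems.TwoPointAssembly
open Summit.HubbardSuperconductivity.HubbardSuperconductivity.Theorems.EngineV8
open Summit.HubbardSuperconductivity.HubbardSuperconductivity.Theorems.TwoVolumeDefect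

set_option maxHeartbeats 1600000 in -- one large constructor application plus the budget bookkeeping
/-- **`TowerDataTSW β U μ t` FROM THE SUPPLIERS' READ-OUTS, token #24 in the WINDOWED currency** (see the module docstring). [folklore: composition; cite: BenfattoGiulianiMastropietro2006, §2.7-§2.9 and §3] -/
theorem towerDataTSW_of_readoutsH0WA (β U μ : ℝ) (hβ : 0 < β) (Cw : ℝ) (P : SplitConsts) (Q Q' : EngConsts) (hCE : 0 ≤ Q.CE) (hCE' : 0 ≤ Q'.CE) (hKl : 0 ≤ P.Klam)
    (A : ℕ → ℕ → ℝ) (hA : ∀ j s, 0 ≤ A j s) {t : ℝ} (ht0 : 0 < t) (ht1 : t ≤ 1)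
    (hτ : ∀ j, j ≤ nScales β → ∀ m : ℕ, t * klSrcBudget P Q' U A (j + 1) 1 m + t ^ 2 * klSrcBudget P Q' U A (j + 1) 2 m ≤
      klWtBudget P Q U (j + 1) 2 * (if m ≤ 2 then 1 else klWtBudget P Q' U (j + 1) m))
    (Mth : ℕ → ℕ → ℕ)
    -- constants and laws
    (Λ ΛT κ κf aW sW eW' cW cRb cCb δb : ℕ → ℝ) (sE cR cC δ : ℕ → ℕ → ℝ) (r : ℕ → ℕ) (k₀ a₀ cR₀ cC₀ kf cW₀ δb₀ r₀ C₀ εb : ℝ)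
    (hΛ : ∀ j, 0 < Λ j) (hΛmono : ∀ j, Λ (j + 1) ≤ Λ j) (hΛT : ∀ j, Λ j ≤ ΛT j) (hΛr : ∀ j, j ≤ nScales β → Λ j ≤ klScale klE0 (r j))
    (hk₀ : 0 < k₀) (hκ : ∀ j, 0 < κ j) (hκ2 : ∀ j, κ j ^ 2 = k₀ ^ 2 * ((8 : ℝ) ^ j)⁻¹) (hκfge : ∀ j, κ j ≤ κf j) (hκf : ∀ j, κf j ≤ kf * κ j)
    (hkf : 1 ≤ kf) (haW0 : ∀ j, 0 ≤ aW j) (haW : ∀ j, aW j ≤ a₀ * 4 ^ j) (hsW : ∀ j, 0 ≤ sW j) (heW' : ∀ j, 0 ≤ eW' j)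
    (hcW1 : ∀ j, 1 ≤ cW j) (hcW : ∀ j, cW j ≤ cW₀) (hcRb0 : ∀ j, 0 ≤ cRb j) (hcRb : ∀ j, cRb j ≤ cR₀) (hcCb0 : ∀ j, 0 ≤ cCb j) (hcCb : ∀ j, cCb j ≤ cC₀)
    (hδb0 : ∀ j, 0 ≤ δb j) (hδb : ∀ j, δb j ≤ δb₀) (hr₀0 : 0 ≤ r₀) (hr₀ : 8 * Real.exp 2 * (kf + 1) * (cW₀ + δb₀ + 1) ≤ r₀) (hC₀ : 0 ≤ C₀)
    -- E1's alive budgets with their law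
    (S₀ : ℕ → ℕ → ℝ) (hS₀0 : ∀ j m, 0 ≤ S₀ j m) (hS₀law : ∀ j, j ≤ nScales β → ∀ m, 2 ≤ m → S₀ j (2 * m) ≤ C₀ * klWtBudget P Q U (j + 1) (2 * m))
    (hS₀two : ∀ j, j ≤ nScales β → S₀ j 2 ≤ C₀ * Q.CE * εb * ((4 : ℝ) ^ (j + 1))⁻¹)
    -- the four scale-free inequalities on `ε_{j+1}`, `j ≤ n_β`
    (hε : ∀ j, j ≤ nScales β → 0 < epsCoupling P U (j + 1)) (hεb : ∀ j, j ≤ nScales β → epsCoupling P U (j + 1) ≤ εb)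
    (hεq : ∀ j, j ≤ nScales β → 8 * Q.CE * ((max 1 Cw) ^ 2 * (2 * Real.exp 2 ^ 2 * (1 + r₀) ^ 2 * k₀ ^ 2)) * epsCoupling P U (j + 1) ≤ 1)
    (hεq' : ∀ j, j ≤ nScales β → 8 * Q'.CE * ((max 1 Cw) ^ 2 * (2 * Real.exp 2 ^ 2 * (1 + r₀) ^ 2 * k₀ ^ 2)) * epsCoupling P U (j + 1) ≤ 1)
    (hsmall : ∀ j, j < nScales β → εb *
      (256 * Real.exp 1 ^ 2 * (a₀ + cR₀ + cC₀ + 1) * (42 * cW₀ + 4 * δb₀ + 8 * Real.exp 1) *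
        (2 * (Q.CE * ((max 1 Cw) ^ 2 * (2 * Real.exp 2 ^ 2 * (1 + r₀) ^ 2 * k₀ ^ 2)) / 4 *
          (C₀ * (1 + 8 * Q.CE * ((max 1 Cw) ^ 2 * (2 * Real.exp 2 ^ 2 * (1 + r₀) ^ 2 * k₀ ^ 2))) + 1 +
            εb * Q'.CE * (1 + 8 * Q'.CE * ((max 1 Cw) ^ 2 * (2 * Real.exp 2 ^ 2 * (1 + r₀) ^ 2 * k₀ ^ 2))) / 4)))) ≤ k₀ ^ 2)
    -- (H4) the mismatch rates
    (hmis : ∀ j L, 0 ≤ sE j L ∧ 0 ≤ cR j L ∧ 0 ≤ cC j L ∧ 0 ≤ δ j L ∧ cR j L ≤ cRb j ∧ cC j L ≤ cCb j ∧ δ j L ≤ δb j)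
    (hmis0 : ∀ j, Tendsto (sE j) atTop (𝓝 0) ∧ Tendsto (cR j) atTop (𝓝 0) ∧ Tendsto (cC j) atTop (𝓝 0) ∧ Tendsto (δ j) atTop (𝓝 0))
    -- (H5) the suppliers' conclusions at every admissible instance, eventually in `L`
    (hinst : ∀ᶠ L in atTop, ∀ (b M : ℕ) [NeZero L] [NeZero (b * L)] [NeZero M], Mth L b ≤ M →
      (∀ k, k ≤ nScales β → hubbardEffPartitionFnCT L M β U μ 0 (klFlowFrameU L M β U μ (nScales β + 1)) (klScale klE0 (k + 1)) ≠ 0) ∧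
      (∀ k, k ≤ nScales β → hubbardEffPartitionFnCT (b * L) M β U μ 0 (klFlowFrameU (b * L) M β U μ (nScales β + 1)) (klScale klE0 (k + 1)) ≠ 0) ∧
      (∀ j, j < nScales β → ScaleCovData (klStepCov L M β μ (klFlowFrameU L M β U μ (nScales β + 1)) j) (Λ j) (κ j) (aW j / imagTimeWeight β M) (sW j)) ∧
      (∀ j, j < nScales β →
        ScaleCovData (klStepCov (b * L) M β μ (klFlowFrameU (b * L) M β U μ (nScales β + 1)) j) (Λ j) (κ j) (aW j / imagTimeWeight β M) (sW j)) ∧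
      (∀ j, j ≤ nScales β → ∀ (m : ℕ) (q : Fin m) (w : SpaceTimeIdx L M × SectorLeg (sectorCount j)),
        klWtPinnedSumAt L M β μ (klFlowFrameU L M β U μ (nScales β + 1)) j (r j) m
          (klEffectiveAction L M β U μ (klFlowFrameU L M β U μ (nScales β + 1)) klE0 (j + 1)) q w ≤ S₀ j m) ∧
      (∀ j, j ≤ nScales β → ∀ (m : ℕ) (q : Fin m) (w : SpaceTimeIdx (b * L) M × SectorLeg (sectorCount j)),
        klWtPinnedSumAt (b * L) M β μ (klFlowFrameU (b * L) M β U μ (nScales β + 1)) j (r j) m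
          (klEffectiveAction (b * L) M β U μ (klFlowFrameU (b * L) M β U μ (nScales β + 1)) klE0 (j + 1)) q w ≤ S₀ j m) ∧
      (∀ j, j ≤ nScales β → SourceProfilesAtLevF L M (klSrcBudget P Q' U A (j + 1)) β U μ (klFlowFrameU L M β U μ (nScales β + 1))
        (srcWindowFamily L M) j (r j) (j + 1)) ∧
      (∀ j, j ≤ nScales β →
        SourceProfilesAtLevF (b * L) M (klSrcBudget P Q' U A (j + 1)) β U μ (klFlowFrameU (b * L) M β U μ (nScales β + 1))
          (srcWindowFamily (b * L) M) j (r j) (j + 1)) ∧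
      TowerCrossData L b M β μ (klFlowFrameU L M β U μ (nScales β + 1)) (klFlowFrameU (b * L) M β U μ (nScales β + 1)) (nScales β) (imagTimeWeight β M)
        Λ κ aW sW eW' ΛT cW κf (fun j => sE j L) (fun j => cR j L) (fun j => cC j L) (fun j => δ j L))
    -- (H6) the BASE as a hypothesis (located «BASE-SRC-ROWS», p3 g18: the transfer-row route to it is dead; any route may supply it): the TRUNCATED keyed
    -- defect of the step-`0` states at the `2r_L`-deep pins, canonical radius `r_L = L/(4J+7)`, tends to zero uniformly in the instance
    (h0T : ∀ (k : ℕ) (η : ℝ), 0 < η → ∀ᶠ L in atTop, ∀ (b M : ℕ) [NeZero L] [NeZero (b * L)] [NeZero M], Mth L b ≤ M →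
      ∀ (p : Fin k) (w : SrcLabel (b * L) M 0),
        (∀ i, 2 * (L / (4 * nScales β + 7)) ≤ (w.1.1.2 i).val % L ∧ (w.1.1.2 i).val % L + 2 * (L / (4 * nScales β + 7)) < L) →
        klKeyedDefectTSW L b M β U μ (klFlowFrameU L M β U μ (nScales β + 1)) (klFlowFrameU (b * L) M β U μ (nScales β + 1)) 1 0 k p w ≤ imagTimeWeight β M * η)
 :
    Nonempty (TowerDataTSW β U μ t) := by
  classical
  -- §0 the top scale, the constants `Dq`, `K`, the ratio `q`, the majorant constant `Aj`, the budget `NV`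
  set J := nScales β with hJ
  have hE : 0 < Real.exp 2 := Real.exp_pos 2
  set cs : ℝ := max 1 Cw with hcs
  have hcs1 : 1 ≤ cs := le_max_left _ _
  have hcs0 : 0 < cs := lt_of_lt_of_le one_pos hcs1
  set Dq₀ : ℝ := 2 * Real.exp 2 ^ 2 * (1 + r₀) ^ 2 * k₀ ^ 2 with hDq₀
  have hDq₀0 : 0 < Dq₀ := by positivity
  set Dq : ℝ := cs ^ 2 * (2 * Real.exp 2 ^ 2 * (1 + r₀) ^ 2 * k₀ ^ 2) with hDq
  have hDq0 : 0 < Dq := by positivity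
  set K : ℝ := Q.CE * Dq / 4 * (C₀ * (1 + 8 * Q.CE * Dq) + 1 + εb * Q'.CE * (1 + 8 * Q'.CE * Dq) / 4) with hK
  have hεb0 : 0 ≤ εb := (hε 0 (Nat.zero_le _)).le.trans (hεb 0 (Nat.zero_le _))
  have hK0 : 0 ≤ K := by positivity
  obtain ⟨q, hq⟩ : ∃ q : ℕ → ℝ, ∀ j, q j = (8 : ℝ) ^ j / Dq := ⟨_, fun _ => rfl⟩
  obtain ⟨qκ, hqκ⟩ : ∃ qκ : ℕ → ℝ, ∀ j, qκ j = (8 : ℝ) ^ j / Dq₀ := ⟨_, fun _ => rfl⟩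
  have hq' : ∀ j, qκ j = 1 / (2 * (Real.exp 2 * (κ j + r₀ * κ j)) ^ 2) := fun j => by rw [hqκ, q_of_kappa_law hk₀ hr₀0 (hκ2 j)]
  have hqκq : ∀ j, qκ j = cs ^ 2 * q j := fun j => by rw [hqκ, hq, hDq, hDq₀]; field_simp
  have hq0 : ∀ j, 0 < q j := fun j => by rw [hq]; positivity
  obtain ⟨Aj, hAj⟩ : ∃ Aj : ℕ → ℝ, ∀ j, Aj j = εb * ((32 : ℝ) ^ j)⁻¹ * (2 * K) := ⟨_, fun _ => rfl⟩
  have hε0 : ∀ i, 0 ≤ epsCoupling P U i := fun i => epsCoupling_nonneg' hKl U i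
  have hAj0 : ∀ j, 0 ≤ Aj j := fun j => by rw [hAj]; positivity
  obtain ⟨NV, hNV⟩ : ∃ NV : ℕ → ℕ → ℝ, ∀ j m, NV j m = if j ≤ J then (if m = 0 then 0 else
      S₀ j (2 * m) + t * klSrcBudget P Q' U A (j + 1) 1 (2 * m) + t ^ 2 * klSrcBudget P Q' U A (j + 1) 2 (2 * m)) else 0 := ⟨_, fun _ _ => rfl⟩
  have hSB : ∀ j s m, 0 ≤ klSrcBudget P Q' U A j s m := fun j s m => by
    unfold klSrcBudget
    refine mul_nonneg (hA j s) ?_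
    split_ifs
    · exact zero_le_one
    · exact klWtBudget_nonneg hCE' hKl U j m
  have hNV0 : ∀ j m, 0 ≤ NV j m := fun j m => by
    rw [hNV]
    split_ifs
    · exact le_rfl
    · exact add_nonneg (add_nonneg (hS₀0 j _) (mul_nonneg ht0.le (hSB _ _ _))) (mul_nonneg (sq_nonneg t) (hSB _ _ _))
    · exact le_rfl
  -- §1 the geometric majorant `NV j m ≤ Aj j · q j ^ m`
  have hNVle : ∀ j m, NV j m ≤ Aj j * q j ^ m := by
    intro j m
    have hR : 0 ≤ Aj j * q j ^ m := mul_nonneg (hAj0 j) (pow_nonneg (hq0 j).le m)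
    rw [hNV]
    by_cases hj : j ≤ J
    · rw [if_pos hj]
      rcases Nat.eq_zero_or_pos m with h0 | hm
      · rw [if_pos h0]; exact hR
      · rw [if_neg hm.ne']
        have hεj := hε j hj
        -- S₀ + t S₁ + t² S₂ ≤ S₀ + τ · (Q'-law)
        have h1 : S₀ j (2 * m) + t * klSrcBudget P Q' U A (j + 1) 1 (2 * m) + t ^ 2 * klSrcBudget P Q' U A (j + 1) 2 (2 * m) ≤
            S₀ j (2 * m) + klWtBudget P Q U (j + 1) 2 * (if 2 * m ≤ 2 then 1 else klWtBudget P Q' U (j + 1) (2 * m)) := by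
          linarith [hτ j hj (2 * m)]
        -- ≤ (geometric constant) · q^m
        have hqj : Q.CE * epsCoupling P U (j + 1) * 8 ^ (j + 1) ≤ q j := by
          rw [hq, le_div_iff₀ hDq0, pow_succ]
          have h := hεq j hj
          have h8 : (0 : ℝ) ≤ 8 ^ j := by positivity
          nlinarith [h, h8]
        have hqj' : Q'.CE * epsCoupling P U (j + 1) * 8 ^ (j + 1) ≤ q j := by
          rw [hq, le_div_iff₀ hDq0, pow_succ]
          have h := hεq' j hj
          have h8 : (0 : ℝ) ≤ 8 ^ j := by positivity
          nlinarith [h, h8]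
        have h2 := towerBudget_le_geom' P Q Q' U (j + 1) hCE hCE' hεj (hq0 j) hqj hqj' hC₀ (klWtBudget_nonneg hCE hKl U (j + 1) 2)
          (a₂ := C₀ * Q.CE * εb * ((4 : ℝ) ^ (j + 1))⁻¹) (by positivity) (S₀ j) (hS₀law j hj) (hS₀two j hj) hm
        -- the constant ≤ εb (32^j)⁻¹ 2K
        have h3 := towerBudgetConst_le_laws' P Q Q' U j hCE hCE' hεj (hεb j hj) hDq0 hC₀ (hq j) (klWtBudget_two_eq_inv_pow P Q U (j + 1))
        have h4 := mul_le_mul_of_nonneg_right h3 (pow_nonneg (hq0 j).le m)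
        rw [hAj]
        exact h1.trans (h2.trans h4)
    · rw [if_neg hj]; exact hR
  -- §1b in the windowed currency the budgets need no smoothing: `NV j m ≤ Aj j · q j ^ m ≤ Aj j · qκ j ^ m` (`qκ = c²·q ≥ q`)
  have hNVle' : ∀ j m, NV j m ≤ Aj j * qκ j ^ m := by
    intro j m
    refine (hNVle j m).trans (mul_le_mul_of_nonneg_left ?_ (hAj0 j))
    rw [hqκq]
    exact pow_le_pow_left₀ (hq0 j).le (le_mul_of_one_le_left (hq0 j).le (one_le_pow₀ hcs1)) m
  -- §2 the two smallness inequalities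
  have h2K0 : 0 ≤ 2 * K := by positivity
  obtain ⟨hS, hS'⟩ := towerSmallnessIneq_of_laws_lt J κ aW cRb cCb cW δb Aj (fun _ => εb) hκ2 haW0 haW hcRb0 hcRb hcCb0 hcCb hcW1 hcW
    hδb0 hδb h2K0 (fun _ => hεb0) (fun j _ => by rw [hAj]) (fun j hj => by rw [hK]; exact hsmall j hj)
  -- §3 the Gram constants decrease
  have hκmono : ∀ j, κ (j + 1) ≤ κ j := fun j => by
    have h : κ (j + 1) ^ 2 ≤ κ j ^ 2 := by
      rw [hκ2, hκ2, pow_succ (8 : ℝ) j, mul_inv]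
      have h8 : (0 : ℝ) < ((8 : ℝ) ^ j)⁻¹ := by positivity
      have hk : 0 ≤ k₀ ^ 2 * ((8 : ℝ) ^ j)⁻¹ := by positivity
      nlinarith [hk]
    exact (pow_le_pow_iff_left₀ (hκ _).le (hκ _).le two_ne_zero).1 h
  -- §4 the data bundles with the budget `NV`
  have hdata : ∀ᶠ L in atTop, ∀ (b M : ℕ) [NeZero L] [NeZero (b * L)] [NeZero M], Mth L b ≤ M →
      TowerVolumeDataTSW L M β U μ (klFlowFrameU L M β U μ (nScales β + 1)) (nScales β) (imagTimeWeight β M) t Λ κ aW sW NV ∧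
      TowerVolumeDataTSW (b * L) M β U μ (klFlowFrameU (b * L) M β U μ (nScales β + 1)) (nScales β) (imagTimeWeight β M) t Λ κ aW sW NV ∧
      TowerCrossData L b M β μ (klFlowFrameU L M β U μ (nScales β + 1)) (klFlowFrameU (b * L) M β U μ (nScales β + 1)) (nScales β) (imagTimeWeight β M)
        Λ κ aW sW eW' ΛT cW κf (fun j => sE j L) (fun j => cR j L) (fun j => cC j L) (fun j => δ j L) := by
    filter_upwards [hinst] with L hL
    intro b M iL ibL iM hM
    obtain ⟨hZc, hZf, hcovc, hcovf, h0c, h0f, h24c, h24f, hX⟩ := hL b M hM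
    -- the profile budget of `towerVolumeDataTSW_of_readoutW` agrees with `NV` away from degree `0`
    have hbud : ∀ j, j ≤ J → (fun m : ℕ => if m = 0 then (0 : ℝ) else imagTimeWeight β M *
        (S₀ j (2 * m) + t * klSrcBudget P Q' U A (j + 1) 1 (2 * m) + t ^ 2 * klSrcBudget P Q' U A (j + 1) 2 (2 * m))) =
        fun m => imagTimeWeight β M * NV j m := by
      intro j hj
      funext m
      rw [hNV, if_pos hj]
      split_ifs <;> simp
    have hvol : ∀ {V : ℕ} [NeZero V],
        (∀ k, k ≤ nScales β → hubbardEffPartitionFnCT V M β U μ 0 (klFlowFrameU V M β U μ (nScales β + 1)) (klScale klE0 (k + 1)) ≠ 0) →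
        (∀ j, j < nScales β → ScaleCovData (klStepCov V M β μ (klFlowFrameU V M β U μ (nScales β + 1)) j) (Λ j) (κ j) (aW j / imagTimeWeight β M) (sW j)) →
        (∀ j, j ≤ nScales β → ∀ (m : ℕ) (q : Fin m) (w : SpaceTimeIdx V M × SectorLeg (sectorCount j)),
          klWtPinnedSumAt V M β μ (klFlowFrameU V M β U μ (nScales β + 1)) j (r j) m
            (klEffectiveAction V M β U μ (klFlowFrameU V M β U μ (nScales β + 1)) klE0 (j + 1)) q w ≤ S₀ j m) →
        (∀ j, j ≤ nScales β → SourceProfilesAtLevF V M (klSrcBudget P Q' U A (j + 1)) β U μ (klFlowFrameU V M β U μ (nScales β + 1))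
          (srcWindowFamily V M) j (r j) (j + 1)) →
        TowerVolumeDataTSW V M β U μ (klFlowFrameU V M β U μ (nScales β + 1)) (nScales β) (imagTimeWeight β M) t Λ κ aW sW NV := by
      intro V _ hZ hcov h0 h24
      have hv := towerVolumeDataTSW_of_readoutW hβ U μ (klFlowFrameU V M β U μ (nScales β + 1)) (nScales β) ht0.le Λ κ aW sW r hΛr hZ hcov S₀
        (fun j s m => klSrcBudget P Q' U A (j + 1) s m) hS₀0 (fun j s m => hSB (j + 1) s m) h0 h24
      exact ⟨hv.Z, hv.parity, hv.cov, fun j hj => by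
        have hp := (hv.profile j hj).zeroDegree
        rw [hbud j hj] at hp
        exact hp⟩
    exact ⟨hvol hZc hcovc h0c h24c, hvol hZf hcovf h0f h24f, hX⟩
  -- §5 the package
  exact towerDataTSW_of_lawsH0 β U μ ht0.le ht1 Mth Λ ΛT κ κf aW sW eW' cW cRb cCb δb Aj qκ NV sE cR cC δ kf cW₀ δb₀ r₀ hΛ hΛmono hΛT hκ hκmono hκfge hκf
    hkf haW0 hsW heW' hcW1 hcW hcRb0 hcCb0 hδb0 hδb hr₀ hq' hNV0 hAj0 hNVle' hS hS' hmis hmis0 hdata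
    h0T

end Summit.HubbardSuperconductivity.HubbardSuperconductivity.Theorems.TwoVolumeSource

end
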